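import Literature.Probability.Percolation.SelfRefinementMeasure
import Literature.Probability.Percolation.KohlerSchindlerTassionRSW
import Summits.CriticalPhenomena.CardyFormulaZ2.Theorems.CardySelfRefinementCriticalPathRSWStubCone3Tuple
import Summits.CriticalPhenomena.CardyFormulaZ2.Theorems.CardySelfRefinementCriticalPathRSWStubCone3Deriv

/-!
# Stub `stub_cone3` of line `finite-size-envelope` (crux `CriticalPathRSW`), part 20:
summing the eighteen pivotality charges over all tuples of the box

Support file for item `stmt-CriticalPhenomena-10267` (stub `stub_cone3`).  For a fixed direction
`d`, the charge `Σ_{g ∈ Π(x, d)} P(g pivotal)` of the tuple based at `3x` (parts 12–18) is summed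
over the sites `x` of the square `[-9n, 9n]²`: each of the eighteen labels of `Π(x, d)` is an
injective function of `x`, is interior, and is pivotal with probability zero unless it lies in the
box; hence (`Cone3.sum_PS_le`)

`Σ_{x} Σ_{g ∈ Π(x, d)} P(g pivotal) ≤ 18 · Σ_{y} (piv(y, d) + piv(y, d'))`,

`piv(y, δ) = P((y, δ) pivotal)` for interior `(y, δ)` and `0` otherwise.

References: Aizenman–Grimmett 1991 §3 (bounded overlap of the local modifications).
-/

noncomputable section

namespace Summit.CriticalPhenomena.CardyFormulaZ2.Cruxes.CriticalPathRSW.FiniteSizeEnvelope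

open Set MeasureTheory
open Literature.Probability.LatticeModels Literature.Probability.Percolation

namespace Cone3

variable {n : ℕ} {ρ c : ℝ} {d d' : Fin 2}

set_option quotPrecheck false

/-- The frame of the tuple based at `3x`: `ptx⟪x, α, β⟫ = 3x + α e_d + β e_{d'}`. -/
local notation "ptx⟪" x ", " α ", " β "⟫" =>
  ((3 : ℤ) • x + (α : ℤ) • (Pi.single d (1 : ℤ) : Site 2) + (β : ℤ) • (Pi.single d' (1 : ℤ) : Site 2))

/-- The open labels of a coin configuration. -/
local notation "Op⟪" S "⟫" => {e : Site 2 × Fin 2 | RefinementOpen 3 S e}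

/-- Crossing of the box by a label configuration. -/
local notation "Cr⟪" V "⟫" => (edgeConfig V ∈ KST2023.crossing (3 * n) (3 * (3 * n)))

/-- Pivotality of the own coin of the interior label `g`. -/
local notation "Piv⟪" g "⟫" =>
  ({S : Set (Site 2 × Fin 2 × Fin 3) |
      edgeConfig ((Op⟪S⟫ \ {g}) ∪ {g}) ∈ KST2023.crossing (3 * n) (3 * (3 * n))} \
    {S : Set (Site 2 × Fin 2 × Fin 3) |
      edgeConfig ((Op⟪S⟫ \ {g}) ∪ ∅) ∈ KST2023.crossing (3 * n) (3 * (3 * n))})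

/-- The coin law. -/
local notation "P" => (prodBernoulli (refinementParam 3 ρ c))

/-- The interior pivotality weight of a label. -/
local notation "piv⟪" g "⟫" => (if ¬ IsAxialEdge 3 g then (P).real Piv⟪g⟫ else 0)

/-- The eighteen interior labels next to the tuple based at `3x`. -/
local notation "Πfx⟪" x "⟫" => ({(ptx⟪x, 0, 1⟫, d), (ptx⟪x, 1, 0⟫, d'), (ptx⟪x, -1, 0⟫, d'), (ptx⟪x, -1, 1⟫, d), (ptx⟪x, 2, 1⟫, d), (ptx⟪x, 2, 0⟫, d'), (ptx⟪x, 4, 0⟫, d'), (ptx⟪x, 3, 1⟫, d), (ptx⟪x, 1, 1⟫, d), (ptx⟪x, 0, -1⟫, d), (ptx⟪x, 1, -1⟫, d'), (ptx⟪x, -1, -1⟫, d'), (ptx⟪x, -1, -1⟫, d), (ptx⟪x, 2, -1⟫, d), (ptx⟪x, 2, -1⟫, d'), (ptx⟪x, 4, -1⟫, d'), (ptx⟪x, 3, -1⟫, d), (ptx⟪x, 1, -1⟫, d)} : Finset (Site 2 × Fin 2))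

/-- The sites of the square `[-9n, 9n]²`. -/
local notation "Kx" => (Fintype.piFinset fun _ : Fin 2 => Finset.Icc (-(9 * (n : ℤ))) (9 * (n : ℤ)))

/-! ### Labels outside the box are never pivotal -/

/-- A label based outside the square is pivotal with probability zero. -/
theorem real_piv_eq_zero_of_not_mem {y : Site 2} (hy : y ∉ Kx) (δ : Fin 2) : (P).real Piv⟪(y, δ)⟫ = 0 := by
  have hbox : y ∉ KST2023.box (3 * n) (3 * (3 * n)) := fun h => hy (mem_Kx_of_mem_box h)
  have heq : {S : Set (Site 2 × Fin 2 × Fin 3) | Cr⟪(Op⟪S⟫ \ {(y, δ)}) ∪ {(y, δ)}⟫} =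
      {S : Set (Site 2 × Fin 2 × Fin 3) | Cr⟪(Op⟪S⟫ \ {(y, δ)}) ∪ ∅⟫} := by
    ext S
    simp only [Set.mem_setOf_eq, Set.union_empty]
    exact cr_union_iff_of_not_mem_box (fun ℓ hℓ h => hbox (by rw [Set.mem_singleton_iff.1 hℓ] at h; exact h.1))
  rw [heq, Set.sdiff_self, measureReal_empty]

/-! ### One pattern -/

/-- `x ↦ 3x + v` is injective. -/
theorem injective_frame (v : Site 2) : Function.Injective fun x : Site 2 => (3 : ℤ) • x + v := by
  intro x x' h
  have h' : (3 : ℤ) • x = (3 : ℤ) • x' := add_right_cancel h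
  funext i
  have := congr_fun h' i
  simp only [Pi.smul_apply, smul_eq_mul] at this
  omega

/-- **One pattern.** For an injective family of interior labels of direction `δ`,
`Σ_{x ∈ Kx} P((φ x, δ) pivotal) ≤ Σ_{y ∈ Kx} piv(y, δ)`. -/
theorem sum_pattern_le {φ : Site 2 → Site 2} (hφ : Function.Injective φ) {δ : Fin 2}
    (hint : ∀ x, ¬ IsAxialEdge 3 (φ x, δ)) :
    ∑ x ∈ Kx, (P).real Piv⟪(φ x, δ)⟫ ≤ ∑ y ∈ Kx, piv⟪(y, δ)⟫ := by
  classical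
  rw [← Finset.sum_image (f := fun y => (P).real Piv⟪(y, δ)⟫) (fun x _ x' _ h => hφ h)]
  rw [← Finset.sum_filter_add_sum_filter_not ((Kx).image φ) (fun y => y ∈ Kx)]
  have hzero : ∑ y ∈ ((Kx).image φ).filter (fun y => y ∉ Kx), (P).real Piv⟪(y, δ)⟫ = 0 :=
    Finset.sum_eq_zero fun y hy => real_piv_eq_zero_of_not_mem (Finset.mem_filter.1 hy).2 δ
  rw [hzero, add_zero]
  have hsub : ((Kx).image φ).filter (fun y => y ∈ Kx) ⊆ Kx := fun y hy => (Finset.mem_filter.1 hy).2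
  calc ∑ y ∈ ((Kx).image φ).filter (fun y => y ∈ Kx), (P).real Piv⟪(y, δ)⟫
      = ∑ y ∈ ((Kx).image φ).filter (fun y => y ∈ Kx), piv⟪(y, δ)⟫ := by
        refine Finset.sum_congr rfl fun y hy => ?_
        obtain ⟨x, -, rfl⟩ := Finset.mem_image.1 (Finset.mem_filter.1 hy).1
        rw [if_pos (hint x)]
    _ ≤ ∑ y ∈ Kx, piv⟪(y, δ)⟫ := by
        refine Finset.sum_le_sum_of_subset_of_nonneg hsub fun y _ _ => ?_
        split_ifs
        · exact le_rfl
        · exact measureReal_nonneg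

/-- One pattern of the frame: `Σ_{x} P((3x + α e_d + β e_{d'}, δ) pivotal) ≤ Σ_y (piv(y, d) + piv(y, d'))`. -/
theorem sum_frame_pattern_le (hd : d' ≠ d) (α β : ℤ) {δ : Fin 2}
    (hint : ∀ x : Site 2, ¬ IsAxialEdge 3 (ptx⟪x, α, β⟫, δ)) :
    ∑ x ∈ Kx, (P).real Piv⟪(ptx⟪x, α, β⟫, δ)⟫ ≤ ∑ y ∈ Kx, (piv⟪(y, d)⟫ + piv⟪(y, d')⟫) := by
  have hinj : Function.Injective fun x : Site 2 => ptx⟪x, α, β⟫ := by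
    intro x x' h
    refine injective_frame ((α : ℤ) • (Pi.single d (1 : ℤ) : Site 2) + (β : ℤ) • (Pi.single d' (1 : ℤ) : Site 2)) ?_
    simp only [← add_assoc]
    exact h
  have h := sum_pattern_le (n := n) (ρ := ρ) (c := c) hinj hint
  have hnn : ∀ y (e : Fin 2), (0 : ℝ) ≤ piv⟪(y, e)⟫ := by
    intro y e; split_ifs
    · exact le_rfl
    · exact measureReal_nonneg
  rcases fin2_eq_or hd δ with rfl | rfl
  · exact h.trans (Finset.sum_le_sum fun y _ => le_add_of_nonneg_right (hnn y d'))
  · exact h.trans (Finset.sum_le_sum fun y _ => le_add_of_nonneg_left (hnn y d))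

/-! ### The eighteen patterns -/

/-- A finite sum over an inserted element is at most the new term plus the old sum. -/
theorem sum_insert_le' {f : Site 2 × Fin 2 → ℝ} (hf : ∀ g, 0 ≤ f g) (a : Site 2 × Fin 2) (s : Finset (Site 2 × Fin 2)) :
    ∑ g ∈ insert a s, f g ≤ f a + ∑ g ∈ s, f g := by
  classical
  by_cases h : a ∈ s
  · rw [Finset.insert_eq_of_mem h]; linarith [hf a]
  · rw [Finset.sum_insert h]

/-- The charge of a tuple is at most the sum of its eighteen pivotality probabilities. -/
theorem PS_le_explicit (x : Site 2) :
    ∑ g ∈ Πfx⟪x⟫, (P).real Piv⟪g⟫ ≤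
      (P).real Piv⟪(ptx⟪x, 0, 1⟫, d)⟫ +
        ((P).real Piv⟪(ptx⟪x, 1, 0⟫, d')⟫ +
        ((P).real Piv⟪(ptx⟪x, -1, 0⟫, d')⟫ +
        ((P).real Piv⟪(ptx⟪x, -1, 1⟫, d)⟫ +
        ((P).real Piv⟪(ptx⟪x, 2, 1⟫, d)⟫ +
        ((P).real Piv⟪(ptx⟪x, 2, 0⟫, d')⟫ +
        ((P).real Piv⟪(ptx⟪x, 4, 0⟫, d')⟫ +
        ((P).real Piv⟪(ptx⟪x, 3, 1⟫, d)⟫ +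
        ((P).real Piv⟪(ptx⟪x, 1, 1⟫, d)⟫ +
        ((P).real Piv⟪(ptx⟪x, 0, -1⟫, d)⟫ +
        ((P).real Piv⟪(ptx⟪x, 1, -1⟫, d')⟫ +
        ((P).real Piv⟪(ptx⟪x, -1, -1⟫, d')⟫ +
        ((P).real Piv⟪(ptx⟪x, -1, -1⟫, d)⟫ +
        ((P).real Piv⟪(ptx⟪x, 2, -1⟫, d)⟫ +
        ((P).real Piv⟪(ptx⟪x, 2, -1⟫, d')⟫ +
        ((P).real Piv⟪(ptx⟪x, 4, -1⟫, d')⟫ +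
        ((P).real Piv⟪(ptx⟪x, 3, -1⟫, d)⟫ +
        ((P).real Piv⟪(ptx⟪x, 1, -1⟫, d)⟫))))))))))))))))) := by
  have hf : ∀ g : Site 2 × Fin 2, 0 ≤ (P).real Piv⟪g⟫ := fun _ => measureReal_nonneg
  have h1 := sum_insert_le' hf (ptx⟪x, 0, 1⟫, d)
    ({(ptx⟪x, 1, 0⟫, d'), (ptx⟪x, -1, 0⟫, d'), (ptx⟪x, -1, 1⟫, d), (ptx⟪x, 2, 1⟫, d), (ptx⟪x, 2, 0⟫, d'), (ptx⟪x, 4, 0⟫, d'), (ptx⟪x, 3, 1⟫, d), (ptx⟪x, 1, 1⟫, d), (ptx⟪x, 0, -1⟫, d), (ptx⟪x, 1, -1⟫, d'), (ptx⟪x, -1, -1⟫, d'), (ptx⟪x, -1, -1⟫, d), (ptx⟪x, 2, -1⟫, d), (ptx⟪x, 2, -1⟫, d'), (ptx⟪x, 4, -1⟫, d'), (ptx⟪x, 3, -1⟫, d), (ptx⟪x, 1, -1⟫, d)} : Finset (Site 2 × Fin 2))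
  have h2 := sum_insert_le' hf (ptx⟪x, 1, 0⟫, d')
    ({(ptx⟪x, -1, 0⟫, d'), (ptx⟪x, -1, 1⟫, d), (ptx⟪x, 2, 1⟫, d), (ptx⟪x, 2, 0⟫, d'), (ptx⟪x, 4, 0⟫, d'), (ptx⟪x, 3, 1⟫, d), (ptx⟪x, 1, 1⟫, d), (ptx⟪x, 0, -1⟫, d), (ptx⟪x, 1, -1⟫, d'), (ptx⟪x, -1, -1⟫, d'), (ptx⟪x, -1, -1⟫, d), (ptx⟪x, 2, -1⟫, d), (ptx⟪x, 2, -1⟫, d'), (ptx⟪x, 4, -1⟫, d'), (ptx⟪x, 3, -1⟫, d), (ptx⟪x, 1, -1⟫, d)} : Finset (Site 2 × Fin 2))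
  have h3 := sum_insert_le' hf (ptx⟪x, -1, 0⟫, d')
    ({(ptx⟪x, -1, 1⟫, d), (ptx⟪x, 2, 1⟫, d), (ptx⟪x, 2, 0⟫, d'), (ptx⟪x, 4, 0⟫, d'), (ptx⟪x, 3, 1⟫, d), (ptx⟪x, 1, 1⟫, d), (ptx⟪x, 0, -1⟫, d), (ptx⟪x, 1, -1⟫, d'), (ptx⟪x, -1, -1⟫, d'), (ptx⟪x, -1, -1⟫, d), (ptx⟪x, 2, -1⟫, d), (ptx⟪x, 2, -1⟫, d'), (ptx⟪x, 4, -1⟫, d'), (ptx⟪x, 3, -1⟫, d), (ptx⟪x, 1, -1⟫, d)} : Finset (Site 2 × Fin 2))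
  have h4 := sum_insert_le' hf (ptx⟪x, -1, 1⟫, d)
    ({(ptx⟪x, 2, 1⟫, d), (ptx⟪x, 2, 0⟫, d'), (ptx⟪x, 4, 0⟫, d'), (ptx⟪x, 3, 1⟫, d), (ptx⟪x, 1, 1⟫, d), (ptx⟪x, 0, -1⟫, d), (ptx⟪x, 1, -1⟫, d'), (ptx⟪x, -1, -1⟫, d'), (ptx⟪x, -1, -1⟫, d), (ptx⟪x, 2, -1⟫, d), (ptx⟪x, 2, -1⟫, d'), (ptx⟪x, 4, -1⟫, d'), (ptx⟪x, 3, -1⟫, d), (ptx⟪x, 1, -1⟫, d)} : Finset (Site 2 × Fin 2))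
  have h5 := sum_insert_le' hf (ptx⟪x, 2, 1⟫, d)
    ({(ptx⟪x, 2, 0⟫, d'), (ptx⟪x, 4, 0⟫, d'), (ptx⟪x, 3, 1⟫, d), (ptx⟪x, 1, 1⟫, d), (ptx⟪x, 0, -1⟫, d), (ptx⟪x, 1, -1⟫, d'), (ptx⟪x, -1, -1⟫, d'), (ptx⟪x, -1, -1⟫, d), (ptx⟪x, 2, -1⟫, d), (ptx⟪x, 2, -1⟫, d'), (ptx⟪x, 4, -1⟫, d'), (ptx⟪x, 3, -1⟫, d), (ptx⟪x, 1, -1⟫, d)} : Finset (Site 2 × Fin 2))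
  have h6 := sum_insert_le' hf (ptx⟪x, 2, 0⟫, d')
    ({(ptx⟪x, 4, 0⟫, d'), (ptx⟪x, 3, 1⟫, d), (ptx⟪x, 1, 1⟫, d), (ptx⟪x, 0, -1⟫, d), (ptx⟪x, 1, -1⟫, d'), (ptx⟪x, -1, -1⟫, d'), (ptx⟪x, -1, -1⟫, d), (ptx⟪x, 2, -1⟫, d), (ptx⟪x, 2, -1⟫, d'), (ptx⟪x, 4, -1⟫, d'), (ptx⟪x, 3, -1⟫, d), (ptx⟪x, 1, -1⟫, d)} : Finset (Site 2 × Fin 2))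
  have h7 := sum_insert_le' hf (ptx⟪x, 4, 0⟫, d')
    ({(ptx⟪x, 3, 1⟫, d), (ptx⟪x, 1, 1⟫, d), (ptx⟪x, 0, -1⟫, d), (ptx⟪x, 1, -1⟫, d'), (ptx⟪x, -1, -1⟫, d'), (ptx⟪x, -1, -1⟫, d), (ptx⟪x, 2, -1⟫, d), (ptx⟪x, 2, -1⟫, d'), (ptx⟪x, 4, -1⟫, d'), (ptx⟪x, 3, -1⟫, d), (ptx⟪x, 1, -1⟫, d)} : Finset (Site 2 × Fin 2))
  have h8 := sum_insert_le' hf (ptx⟪x, 3, 1⟫, d)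
    ({(ptx⟪x, 1, 1⟫, d), (ptx⟪x, 0, -1⟫, d), (ptx⟪x, 1, -1⟫, d'), (ptx⟪x, -1, -1⟫, d'), (ptx⟪x, -1, -1⟫, d), (ptx⟪x, 2, -1⟫, d), (ptx⟪x, 2, -1⟫, d'), (ptx⟪x, 4, -1⟫, d'), (ptx⟪x, 3, -1⟫, d), (ptx⟪x, 1, -1⟫, d)} : Finset (Site 2 × Fin 2))
  have h9 := sum_insert_le' hf (ptx⟪x, 1, 1⟫, d)
    ({(ptx⟪x, 0, -1⟫, d), (ptx⟪x, 1, -1⟫, d'), (ptx⟪x, -1, -1⟫, d'), (ptx⟪x, -1, -1⟫, d), (ptx⟪x, 2, -1⟫, d), (ptx⟪x, 2, -1⟫, d'), (ptx⟪x, 4, -1⟫, d'), (ptx⟪x, 3, -1⟫, d), (ptx⟪x, 1, -1⟫, d)} : Finset (Site 2 × Fin 2))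
  have h10 := sum_insert_le' hf (ptx⟪x, 0, -1⟫, d)
    ({(ptx⟪x, 1, -1⟫, d'), (ptx⟪x, -1, -1⟫, d'), (ptx⟪x, -1, -1⟫, d), (ptx⟪x, 2, -1⟫, d), (ptx⟪x, 2, -1⟫, d'), (ptx⟪x, 4, -1⟫, d'), (ptx⟪x, 3, -1⟫, d), (ptx⟪x, 1, -1⟫, d)} : Finset (Site 2 × Fin 2))
  have h11 := sum_insert_le' hf (ptx⟪x, 1, -1⟫, d')
    ({(ptx⟪x, -1, -1⟫, d'), (ptx⟪x, -1, -1⟫, d), (ptx⟪x, 2, -1⟫, d), (ptx⟪x, 2, -1⟫, d'), (ptx⟪x, 4, -1⟫, d'), (ptx⟪x, 3, -1⟫, d), (ptx⟪x, 1, -1⟫, d)} : Finset (Site 2 × Fin 2))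
  have h12 := sum_insert_le' hf (ptx⟪x, -1, -1⟫, d')
    ({(ptx⟪x, -1, -1⟫, d), (ptx⟪x, 2, -1⟫, d), (ptx⟪x, 2, -1⟫, d'), (ptx⟪x, 4, -1⟫, d'), (ptx⟪x, 3, -1⟫, d), (ptx⟪x, 1, -1⟫, d)} : Finset (Site 2 × Fin 2))
  have h13 := sum_insert_le' hf (ptx⟪x, -1, -1⟫, d)
    ({(ptx⟪x, 2, -1⟫, d), (ptx⟪x, 2, -1⟫, d'), (ptx⟪x, 4, -1⟫, d'), (ptx⟪x, 3, -1⟫, d), (ptx⟪x, 1, -1⟫, d)} : Finset (Site 2 × Fin 2))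
  have h14 := sum_insert_le' hf (ptx⟪x, 2, -1⟫, d)
    ({(ptx⟪x, 2, -1⟫, d'), (ptx⟪x, 4, -1⟫, d'), (ptx⟪x, 3, -1⟫, d), (ptx⟪x, 1, -1⟫, d)} : Finset (Site 2 × Fin 2))
  have h15 := sum_insert_le' hf (ptx⟪x, 2, -1⟫, d')
    ({(ptx⟪x, 4, -1⟫, d'), (ptx⟪x, 3, -1⟫, d), (ptx⟪x, 1, -1⟫, d)} : Finset (Site 2 × Fin 2))
  have h16 := sum_insert_le' hf (ptx⟪x, 4, -1⟫, d')
    ({(ptx⟪x, 3, -1⟫, d), (ptx⟪x, 1, -1⟫, d)} : Finset (Site 2 × Fin 2))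
  have h17 := sum_insert_le' hf (ptx⟪x, 3, -1⟫, d)
    ({(ptx⟪x, 1, -1⟫, d)} : Finset (Site 2 × Fin 2))
  have h18 : ∑ g ∈ ({(ptx⟪x, 1, -1⟫, d)} : Finset (Site 2 × Fin 2)), (P).real Piv⟪g⟫ = (P).real Piv⟪(ptx⟪x, 1, -1⟫, d)⟫ :=
    Finset.sum_singleton _ _
  linarith

/-- **The sum of the charges over all tuples of one direction.** -/
theorem sum_PS_le (hd : d' ≠ d) :
    ∑ x ∈ Kx, ∑ g ∈ Πfx⟪x⟫, (P).real Piv⟪g⟫ ≤ 18 * ∑ y ∈ Kx, (piv⟪(y, d)⟫ + piv⟪(y, d')⟫) := by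
  have h1 : ¬ (3 : ℤ) ∣ 1 := by decide
  have hm1 : ¬ (3 : ℤ) ∣ -1 := by decide
  have h2 : ¬ (3 : ℤ) ∣ 2 := by decide
  have h4 : ¬ (3 : ℤ) ∣ 4 := by decide
  have hD : ∀ (α : ℤ) {β : ℤ}, ¬ (3 : ℤ) ∣ β → ∀ x : Site 2, ¬ IsAxialEdge 3 (ptx⟪x, α, β⟫, d) := by
    intro α β hβ x; rw [isAxialEdge_pt_d hd]; exact hβ
  have hD' : ∀ {α : ℤ} (β : ℤ), ¬ (3 : ℤ) ∣ α → ∀ x : Site 2, ¬ IsAxialEdge 3 (ptx⟪x, α, β⟫, d') := by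
    intro α β hα x; rw [isAxialEdge_pt_d' hd]; exact hα
  refine (Finset.sum_le_sum fun x _ => PS_le_explicit (n := n) (ρ := ρ) (c := c) (d := d) (d' := d') x).trans ?_
  have s1 := sum_frame_pattern_le (n := n) (ρ := ρ) (c := c) hd 0 1 (hD 0 h1)
  have s2 := sum_frame_pattern_le (n := n) (ρ := ρ) (c := c) hd 1 0 (hD' 0 h1)
  have s3 := sum_frame_pattern_le (n := n) (ρ := ρ) (c := c) hd (-1) 0 (hD' 0 hm1)
  have s4 := sum_frame_pattern_le (n := n) (ρ := ρ) (c := c) hd (-1) 1 (hD (-1) h1)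
  have s5 := sum_frame_pattern_le (n := n) (ρ := ρ) (c := c) hd 2 1 (hD 2 h1)
  have s6 := sum_frame_pattern_le (n := n) (ρ := ρ) (c := c) hd 2 0 (hD' 0 h2)
  have s7 := sum_frame_pattern_le (n := n) (ρ := ρ) (c := c) hd 4 0 (hD' 0 h4)
  have s8 := sum_frame_pattern_le (n := n) (ρ := ρ) (c := c) hd 3 1 (hD 3 h1)
  have s9 := sum_frame_pattern_le (n := n) (ρ := ρ) (c := c) hd 1 1 (hD 1 h1)
  have s10 := sum_frame_pattern_le (n := n) (ρ := ρ) (c := c) hd 0 (-1) (hD 0 hm1)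
  have s11 := sum_frame_pattern_le (n := n) (ρ := ρ) (c := c) hd 1 (-1) (hD' (-1) h1)
  have s12 := sum_frame_pattern_le (n := n) (ρ := ρ) (c := c) hd (-1) (-1) (hD' (-1) hm1)
  have s13 := sum_frame_pattern_le (n := n) (ρ := ρ) (c := c) hd (-1) (-1) (hD (-1) hm1)
  have s14 := sum_frame_pattern_le (n := n) (ρ := ρ) (c := c) hd 2 (-1) (hD 2 hm1)
  have s15 := sum_frame_pattern_le (n := n) (ρ := ρ) (c := c) hd 2 (-1) (hD' (-1) h2)
  have s16 := sum_frame_pattern_le (n := n) (ρ := ρ) (c := c) hd 4 (-1) (hD' (-1) h4)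
  have s17 := sum_frame_pattern_le (n := n) (ρ := ρ) (c := c) hd 3 (-1) (hD 3 hm1)
  have s18 := sum_frame_pattern_le (n := n) (ρ := ρ) (c := c) hd 1 (-1) (hD 1 hm1)
  simp only [Finset.sum_add_distrib] at *
  linarith

end Cone3

/-- **Registered sub-goal `stub_cone3_sums` of stub `stub_cone3`** (`Cone3.sum_pattern_le` with all local notations
expanded). -/
theorem stub_cone3_sums : ∀ {n : ℕ} {ρ c : ℝ} {φ : Site 2 → Site 2} (hφ : Function.Injective φ) {δ : Fin 2} (hint : ∀ x, ¬ IsAxialEdge 3 (φ x, δ)), ∑ x ∈ ((Fintype.piFinset fun _ : Fin 2 => Finset.Icc (-(9 * (n : ℤ))) (9 * (n : ℤ)))), (((prodBernoulli (refinementParam 3 ρ c)))).real (({S : Set (Site 2 × Fin 2 × Fin 3) | edgeConfig ((({e : Site 2 × Fin 2 | RefinementOpen 3 (S) e}) \ {((φ x, δ))}) ∪ {((φ x, δ))}) ∈ KST2023.crossing (3 * n) (3 * (3 * n))} \ {S : Set (Site 2 × Fin 2 × Fin 3) | edgeConfig ((({e : Site 2 × Fin 2 | RefinementOpen 3 (S)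 e}) \ {((φ x, δ))}) ∪ ∅) ∈ KST2023.crossing (3 * n) (3 * (3 * n))})) ≤ ∑ y ∈ ((Fintype.piFinset fun _ : Fin 2 => Finset.Icc (-(9 * (n : ℤ))) (9 * (n : ℤ)))), ((if ¬ IsAxialEdge 3 ((y, δ)) then (((prodBernoulli (refinementParam 3 ρ c)))).real (({S : Set (Site 2 × Fin 2 × Fin 3) | edgeConfig ((({e : Site 2 × Fin 2 | RefinementOpen 3 (S) e}) \ {(((y, δ)))}) ∪ {(((y, δ)))}) ∈ KST2023.crossing (3 * n) (3 * (3 * n))} \ {S : Set (Site 2 × Fin 2 × Fin 3) | edgeConfig ((({e : Site 2 × Fin 2 | RefinementOpen 3 (S) e}) \ {(((y, δ)))}) ∪ ∅) ∈ KST2023.crossing (3 * n) (3 * (3 * n))})) else 0)) := by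
  intro n ρ c φ hφ δ hint
  exact Cone3.sum_pattern_le hφ hint

end Summit.CriticalPhenomena.CardyFormulaZ2.Cruxes.CriticalPathRSW.FiniteSizeEnvelope

end
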